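import Summits.HubbardSuperconductivity.HubbardSuperconductivity.Theorems.AnisotropyChordTransferFibre3Hole2Check
import Literature.NumberTheory.LFunctions.VinogradovKorobovNumerics
import Literature.Analysis.ValidatedNumerics.FixedPointInterval

/-!
# Route `AnisotropyChord` / H0 rotor rung: HOLE₂ per-`L` certificates — SOUNDNESS I: the fixed-point interval arithmetic and the `cos` enclosures

Soundness of the computable kit of `…Fibre3Hole2Check` (namespace `Hole2`), read into `ℝ`:
* `mem x I` — the real `x` lies in the fixed-point interval `I = (lo, hi)`: `lo ≤ x·D ≤ hi`, `D = 2^60`;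
* `mem_iadd`, `mem_isub`, `mem_imul` (four-corner product bound `FI.mul_mem_corners` of `Literature/Analysis/ValidatedNumerics/FixedPointInterval`
  + outward rounding; the tree's `FI` kit works at scale `2^48`, the checker at `2^60`, so only the corner lemma is shared), `mem_iinv` (positive intervals),
  `mem_idivn`, `mem_idbl` (`2c² − 1`);
* `mem_cosIv`: `cos(2πm/L) ∈ cosIv L m` for `m < L`, `3 ≤ L` — quarter angle `πm'/(2L) ≤ π/4` bracketed by the alternating
  Taylor sums (`Literature.NumberTheory.LFunctions.VK.cos_taylor_brackets`, `y² ≤ 2`), `π ∈ (piLo, piHi)` (Mathlib's 20-digit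
  bounds), monotonicity of `cos` on `[0, π]`, two doublings `cos 2y = 2cos²y − 1`; the mirror `m ↦ L − m` and the values at `0`, `π`;
* `getIv_cosTab`, `mem_epsIv` (`ε(k) − g_L`), `gFix_ge` (`¾ε₁ ≤ g_L := gFix/D`), `gFix_lt` (`g_L < ε₁` from the check).
Prover seat `hubbard-h0-rotor-p3` g3; helper for stmt-HubbardSuperconductivity-19089 (`--supports`, helper class).
WHAT THIS IS NOT: nothing here proves superconductivity in the Hubbard model (rotor TARGET as worded stays FALSE, g15 verdict);
soundness lemmas for the per-`L` HOLE₂ certificates of ONE conditional reduction (rung 19089). Mathlib + tree imports only; no sorry.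
-/

set_option linter.dupNamespace false
set_option autoImplicit false

namespace Summit.HubbardSuperconductivity.HubbardSuperconductivity.Theorems.AnisotropyChord.Transfer.Fibre3

namespace Hole2

open scoped BigOperators
open Finset

/-! ## Reading fixed-point intervals in `ℝ` -/

/-- `D = 2^60` as a real number. [folklore] -/
theorem D_cast : ((D : ℤ) : ℝ) = 2 ^ 60 := by unfold D; push_cast; norm_num

/-- `0 < D`. [folklore] -/
theorem D_pos : (0 : ℝ) < ((D : ℤ) : ℝ) := by rw [D_cast]; positivity

/-- `0 < D` in `ℤ`. [folklore] -/
theorem D_pos_int : (0 : ℤ) < D := by unfold D; positivity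

/-- the real `x` lies in the fixed-point interval `I`: `lo ≤ x·D ≤ hi`. [folklore] -/
def mem (x : ℝ) (I : Iv) : Prop := (I.1 : ℝ) ≤ x * ((D : ℤ) : ℝ) ∧ x * ((D : ℤ) : ℝ) ≤ (I.2 : ℝ)

/-- floor division: `(a / b)·b ≤ a` for `0 < b`. [folklore] -/
theorem ediv_mul_le_real (a b : ℤ) (hb : 0 < b) : ((a / b : ℤ) : ℝ) * (b : ℝ) ≤ (a : ℝ) := by
  exact_mod_cast Int.ediv_mul_le a (ne_of_gt hb)

/-- ceiling division: `a ≤ (cdiv a b)·b` for `0 < b`. [folklore] -/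
theorem le_cdiv_mul_real (a b : ℤ) (hb : 0 < b) : (a : ℝ) ≤ ((cdiv a b : ℤ) : ℝ) * (b : ℝ) := by
  unfold cdiv
  have h : (((-a) / b : ℤ) : ℝ) * (b : ℝ) ≤ ((-a : ℤ) : ℝ) := by exact_mod_cast Int.ediv_mul_le (-a) (ne_of_gt hb)
  push_cast at h ⊢
  linarith

/-- an exact value. [folklore] -/
theorem mem_exact (a : ℤ) : mem ((a : ℝ) / ((D : ℤ) : ℝ)) (a, a) := by
  unfold mem
  rw [div_mul_cancel₀ _ (ne_of_gt D_pos)]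
  exact ⟨le_rfl, le_rfl⟩

/-- sum. [folklore] -/
theorem mem_iadd {x y : ℝ} {I J : Iv} (hx : mem x I) (hy : mem y J) : mem (x + y) (iadd I J) := by
  unfold mem iadd at *
  obtain ⟨h1, h2⟩ := hx
  obtain ⟨h3, h4⟩ := hy
  push_cast
  constructor <;> nlinarith

/-- difference. [folklore] -/
theorem mem_isub {x y : ℝ} {I J : Iv} (hx : mem x I) (hy : mem y J) : mem (x - y) (isub I J) := by
  unfold mem isub at *
  obtain ⟨h1, h2⟩ := hx
  obtain ⟨h3, h4⟩ := hy
  push_cast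
  constructor <;> nlinarith

/-- product. [folklore] -/
theorem mem_imul {x y : ℝ} {I J : Iv} (hx : mem x I) (hy : mem y J) : mem (x * y) (imul I J) := by
  unfold mem at *
  have hD := D_pos
  set Dr : ℝ := ((D : ℤ) : ℝ) with hDr
  have hb := Literature.Analysis.ValidatedNumerics.Numerics.FI.mul_mem_corners hx hy
  have hP : x * Dr * (y * Dr) = (x * y * Dr) * Dr := by ring
  rw [hP] at hb
  obtain ⟨hlo, hhi⟩ := hb
  unfold imul
  constructor
  · have h1 := ediv_mul_le_real (min (min (I.1 * J.1) (I.1 * J.2)) (min (I.2 * J.1) (I.2 * J.2))) D D_pos_int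
    push_cast at h1
    have h2 : ((min (min (I.1 * J.1) (I.1 * J.2)) (min (I.2 * J.1) (I.2 * J.2)) / D : ℤ) : ℝ) * Dr
        ≤ (x * y * Dr) * Dr := h1.trans hlo
    exact le_of_mul_le_mul_right h2 hD
  · have h1 := le_cdiv_mul_real (max (max (I.1 * J.1) (I.1 * J.2)) (max (I.2 * J.1) (I.2 * J.2))) D D_pos_int
    push_cast at h1
    have h2 : (x * y * Dr) * Dr
        ≤ ((cdiv (max (max (I.1 * J.1) (I.1 * J.2)) (max (I.2 * J.1) (I.2 * J.2))) D : ℤ) : ℝ) * Dr := hhi.trans h1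
    exact le_of_mul_le_mul_right h2 hD

/-- reciprocal of a positive interval. [folklore] -/
theorem mem_iinv {x : ℝ} {I : Iv} (hx : mem x I) (hpos : 0 < I.1) : mem (1 / x) (iinv I) := by
  unfold mem at *
  have hD := D_pos
  obtain ⟨hlo, hhi⟩ := hx
  have hI1 : (0 : ℝ) < (I.1 : ℝ) := by exact_mod_cast hpos
  have hu : 0 < x * ((D : ℤ) : ℝ) := lt_of_lt_of_le hI1 hlo
  have hx0 : 0 < x := (mul_pos_iff_of_pos_right hD).mp hu
  have hI2 : (0 : ℝ) < (I.2 : ℝ) := lt_of_lt_of_le hu hhi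
  have hI2i : (0 : ℤ) < I.2 := by exact_mod_cast hI2
  have hval : 1 / x * ((D : ℤ) : ℝ) = ((D : ℤ) : ℝ) * ((D : ℤ) : ℝ) / (x * ((D : ℤ) : ℝ)) := by
    field_simp
  rw [hval]
  unfold iinv
  constructor
  · have h1 := ediv_mul_le_real (D * D) I.2 hI2i
    have h2 : ((D * D / I.2 : ℤ) : ℝ) ≤ ((D : ℤ) : ℝ) * ((D : ℤ) : ℝ) / (I.2 : ℝ) := by
      rw [le_div_iff₀ hI2]
      have e : ((D * D : ℤ) : ℝ) = ((D : ℤ) : ℝ) * ((D : ℤ) : ℝ) := by push_cast; ring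
      rw [← e]; exact h1
    exact h2.trans (div_le_div_of_nonneg_left (by positivity) hu hhi)
  · have h1 := le_cdiv_mul_real (D * D) I.1 hpos
    have h2 : ((D : ℤ) : ℝ) * ((D : ℤ) : ℝ) / (I.1 : ℝ) ≤ ((cdiv (D * D) I.1 : ℤ) : ℝ) := by
      rw [div_le_iff₀ hI1]
      have e : ((D * D : ℤ) : ℝ) = ((D : ℤ) : ℝ) * ((D : ℤ) : ℝ) := by push_cast; ring
      rw [← e]; exact h1
    exact (div_le_div_of_nonneg_left (by positivity) hI1 hlo).trans h2

/-- division by a positive integer. [folklore] -/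
theorem mem_idivn {x : ℝ} {I : Iv} (hx : mem x I) {n : ℤ} (hn : 0 < n) : mem (x / n) (idivn I n) := by
  unfold mem at *
  have hD := D_pos
  set Dr : ℝ := ((D : ℤ) : ℝ) with hDr
  obtain ⟨hlo, hhi⟩ := hx
  have hnr : (0 : ℝ) < (n : ℝ) := by exact_mod_cast hn
  have hval : x / n * Dr = (x * Dr) / n := by ring
  rw [hval]
  unfold idivn
  constructor
  · have h1 := ediv_mul_le_real I.1 n hn
    rw [le_div_iff₀ hnr]
    exact h1.trans hlo
  · have h1 := le_cdiv_mul_real I.2 n hn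
    rw [div_le_iff₀ hnr]
    exact hhi.trans h1

/-- angle doubling `c ↦ 2c² − 1`. [folklore] -/
theorem mem_idbl {c : ℝ} {I : Iv} (hc : mem c I) : mem (2 * c ^ 2 - 1) (idbl I) := by
  have h := mem_imul hc hc
  unfold mem at h ⊢
  unfold idbl
  obtain ⟨h1, h2⟩ := h
  push_cast
  constructor <;> nlinarith

/-! ## Table lookups -/

/-- reading a mapped `range`. [folklore] -/
theorem getD_map_range {α : Type} (f : ℕ → α) (d : α) {n i : ℕ} (hi : i < n) :
    ((List.range n).map f).getD i d = f i := by
  rw [List.getD_eq_getElem?_getD, List.getElem?_map, List.getElem?_range hi]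
  rfl

/-- `getIv (cosTab L) k = cosIv L k` for `k < L`. [folklore] -/
theorem getIv_cosTab {L k : ℕ} (hk : k < L) : getIv (cosTab L) k = cosIv L k := by
  unfold getIv cosTab
  exact getD_map_range _ _ hk

/-! ## The `cos` enclosures -/

/-- the Taylor sums read in `ℝ`. [folklore] -/
theorem taylorLo_cast (y : ℚ) :
    ((taylorLo y : ℚ) : ℝ) = ∑ i ∈ range (2 * 4), (-1) ^ i * ((y : ℝ) ^ (2 * i) / (2 * i).factorial) := by
  unfold taylorLo; push_cast; rfl

/-- the Taylor sums read in `ℝ`. [folklore] -/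
theorem taylorHi_cast (y : ℚ) :
    ((taylorHi y : ℚ) : ℝ) = ∑ i ∈ range (2 * 4 + 1), (-1) ^ i * ((y : ℝ) ^ (2 * i) / (2 * i).factorial) := by
  unfold taylorHi; push_cast; rfl

/-- `piLo < π < piHi` read in `ℝ`. [folklore] -/
theorem pi_mem : ((piLo : ℚ) : ℝ) < Real.pi ∧ Real.pi < ((piHi : ℚ) : ℝ) := by
  unfold piLo piHi
  constructor
  · have h := Real.pi_gt_d20; push_cast; norm_num at h ⊢; linarith
  · have h := Real.pi_lt_d20; push_cast; norm_num at h ⊢; linarith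

/-- the quarter-angle enclosure: for `0 < m'`, `2m' < L`, `y = πm'/(2L)`,
`⌊taylorLo(m' piHi/2L)·D⌋ ≤ cos y · D ≤ ⌈taylorHi(m' piLo/2L)·D⌉`. [folklore] -/
theorem mem_cos_quarter {L mm : ℕ} (hmm : 0 < mm) (h2 : 2 * mm < L) :
    mem (Real.cos (Real.pi * mm / (2 * L)))
      (⌊taylorLo (((mm : ℕ) : ℚ) * piHi / (2 * L)) * (D : ℚ)⌋, ⌈taylorHi (((mm : ℕ) : ℚ) * piLo / (2 * L)) * (D : ℚ)⌉) := by
  have hL : (0 : ℝ) < L := by exact_mod_cast (show 0 < L by omega)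
  have hmmr : (0 : ℝ) < mm := by exact_mod_cast hmm
  obtain ⟨hplo, hphi⟩ := pi_mem
  have hpiLo_pos : (0 : ℝ) < ((piLo : ℚ) : ℝ) := by unfold piLo; push_cast; norm_num
  have hpiHi_lt : ((piHi : ℚ) : ℝ) < 3.15 := by unfold piHi; push_cast; norm_num
  set y : ℝ := Real.pi * mm / (2 * L) with hy
  set ylo : ℝ := ((piLo : ℚ) : ℝ) * mm / (2 * L) with hylo
  set yhi : ℝ := ((piHi : ℚ) : ℝ) * mm / (2 * L) with hyhi
  have hfrac : (mm : ℝ) / (2 * L) < 1 / 4 := by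
    rw [div_lt_div_iff₀ (by positivity) (by norm_num)]
    have : (2 * mm : ℝ) < L := by exact_mod_cast h2
    linarith
  have hfrac0 : 0 < (mm : ℝ) / (2 * L) := div_pos hmmr (by positivity)
  have hylo0 : 0 ≤ ylo := by positivity
  have hylo_le : ylo ≤ y := by
    rw [hylo, hy]; exact div_le_div_of_nonneg_right (by nlinarith) (by positivity)
  have hy_le : y ≤ yhi := by
    rw [hyhi, hy]; exact div_le_div_of_nonneg_right (by nlinarith) (by positivity)
  have hyhi_lt : yhi < 0.7875 := by
    have e : yhi = ((piHi : ℚ) : ℝ) * ((mm : ℝ) / (2 * L)) := by rw [hyhi]; ring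
    rw [e]
    calc ((piHi : ℚ) : ℝ) * ((mm : ℝ) / (2 * L)) < 3.15 * (1 / 4) :=
          mul_lt_mul'' hpiHi_lt hfrac (by unfold piHi; push_cast; norm_num) hfrac0.le
      _ = 0.7875 := by norm_num
  have hyhi_pi : yhi ≤ Real.pi := by linarith [Real.pi_gt_three]
  have hy0 : 0 ≤ y := hylo0.trans hylo_le
  -- monotonicity of cos on [0, π]
  have hc1 : Real.cos yhi ≤ Real.cos y := Real.cos_le_cos_of_nonneg_of_le_pi hy0 hyhi_pi hy_le
  have hc2 : Real.cos y ≤ Real.cos ylo :=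
    Real.cos_le_cos_of_nonneg_of_le_pi hylo0 (hy_le.trans hyhi_pi) hylo_le
  -- Taylor brackets
  have hsq_hi : yhi ^ 2 ≤ 2 := by nlinarith [hylo0.trans (hylo_le.trans hy_le)]
  have hsq_lo : ylo ^ 2 ≤ 2 := by nlinarith [hylo_le.trans hy_le]
  have hT1 := (Literature.NumberTheory.LFunctions.VK.cos_taylor_brackets (hylo0.trans (hylo_le.trans hy_le)) hsq_hi 4).1
  have hT2 := (Literature.NumberTheory.LFunctions.VK.cos_taylor_brackets hylo0 hsq_lo 4).2
  have eq1 : ((taylorLo (((mm : ℕ) : ℚ) * piHi / (2 * L)) : ℚ) : ℝ)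
      = ∑ i ∈ range (2 * 4), (-1) ^ i * (yhi ^ (2 * i) / (2 * i).factorial) := by
    rw [taylorLo_cast]; push_cast; rw [hyhi]; ring_nf
  have eq2 : ((taylorHi (((mm : ℕ) : ℚ) * piLo / (2 * L)) : ℚ) : ℝ)
      = ∑ i ∈ range (2 * 4 + 1), (-1) ^ i * (ylo ^ (2 * i) / (2 * i).factorial) := by
    rw [taylorHi_cast]; push_cast; rw [hylo]; ring_nf
  have hD := D_pos
  unfold mem
  constructor
  · have hfl := Int.floor_le (taylorLo (((mm : ℕ) : ℚ) * piHi / (2 * L)) * (D : ℚ))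
    have hfl' : ((⌊taylorLo (((mm : ℕ) : ℚ) * piHi / (2 * L)) * (D : ℚ)⌋ : ℤ) : ℝ)
        ≤ ((taylorLo (((mm : ℕ) : ℚ) * piHi / (2 * L)) : ℚ) : ℝ) * ((D : ℤ) : ℝ) := by
      have := (Rat.cast_le (K := ℝ)).mpr hfl
      push_cast at this ⊢
      exact this
    refine hfl'.trans ?_
    rw [eq1]
    exact mul_le_mul_of_nonneg_right (hT1.trans hc1) hD.le
  · have hce := Int.le_ceil (taylorHi (((mm : ℕ) : ℚ) * piLo / (2 * L)) * (D : ℚ))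
    have hce' : ((taylorHi (((mm : ℕ) : ℚ) * piLo / (2 * L)) : ℚ) : ℝ) * ((D : ℤ) : ℝ)
        ≤ ((⌈taylorHi (((mm : ℕ) : ℚ) * piLo / (2 * L)) * (D : ℚ)⌉ : ℤ) : ℝ) := by
      have := (Rat.cast_le (K := ℝ)).mpr hce
      push_cast at this ⊢
      exact this
    refine le_trans ?_ hce'
    rw [eq2]
    exact mul_le_mul_of_nonneg_right (hc2.trans hT2) hD.le

/-- ★ `cos(2πm/L) ∈ cosIv L m` for `m < L`, `3 ≤ L`. [folklore] -/
theorem mem_cosIv {L m : ℕ} (hL : 3 ≤ L) (hm : m < L) : mem (Real.cos (2 * Real.pi * m / L)) (cosIv L m) := by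
  unfold cosIv
  by_cases hm0 : m = 0
  · subst hm0
    rw [if_pos rfl, show (2 * Real.pi * ((0 : ℕ) : ℝ) / L) = 0 by simp, Real.cos_zero]
    have h1 := mem_exact D
    rw [div_self (ne_of_gt D_pos)] at h1
    exact h1
  rw [if_neg hm0]
  set mm : ℕ := (if 2 * m ≤ L then m else L - m) with hmm
  have hL0 : (0 : ℝ) < L := by exact_mod_cast (show 0 < L by omega)
  have hcos : Real.cos (2 * Real.pi * m / L) = Real.cos (2 * Real.pi * mm / L) := by
    by_cases h2m : 2 * m ≤ L
    · rw [hmm, if_pos h2m]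
    · rw [hmm, if_neg h2m, Nat.cast_sub hm.le]
      rw [show 2 * Real.pi * ((L : ℝ) - m) / L = 2 * Real.pi - 2 * Real.pi * m / L by
        rw [mul_sub, sub_div, mul_div_assoc, div_self (ne_of_gt hL0), mul_one]]
      rw [Real.cos_two_pi_sub]
  have hcase : (2 * m ≤ L ∧ mm = m) ∨ (¬ 2 * m ≤ L ∧ mm = L - m) := by
    by_cases h2m : 2 * m ≤ L
    · exact Or.inl ⟨h2m, by rw [hmm, if_pos h2m]⟩
    · exact Or.inr ⟨h2m, by rw [hmm, if_neg h2m]⟩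
  have hmm0 : 0 < mm := by rcases hcase with ⟨h, e⟩ | ⟨h, e⟩ <;> omega
  have hmmL : 2 * mm ≤ L := by rcases hcase with ⟨h, e⟩ | ⟨h, e⟩ <;> omega
  rw [hcos]
  by_cases hpi : 2 * mm = L
  · rw [if_pos hpi]
    have hmmr : (0 : ℝ) < mm := by exact_mod_cast hmm0
    have e : 2 * Real.pi * mm / L = Real.pi := by
      have : (L : ℝ) = 2 * mm := by exact_mod_cast hpi.symm
      rw [this, mul_comm 2 Real.pi, mul_assoc, mul_div_assoc, div_self (by positivity), mul_one]
    rw [e, Real.cos_pi]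
    have h1 := mem_exact (-D)
    have e2 : (((-D : ℤ)) : ℝ) / ((D : ℤ) : ℝ) = -1 := by
      rw [Int.cast_neg, neg_div, div_self (ne_of_gt D_pos)]
    rw [e2] at h1
    exact h1
  rw [if_neg hpi]
  have h2 : 2 * mm < L := lt_of_le_of_ne hmmL hpi
  have hq := mem_cos_quarter hmm0 h2
  have e4 : Real.cos (2 * Real.pi * mm / L) = 2 * (2 * Real.cos (Real.pi * mm / (2 * L)) ^ 2 - 1) ^ 2 - 1 := by
    rw [show 2 * Real.pi * mm / L = 2 * (2 * (Real.pi * mm / (2 * L))) by ring,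
      Real.cos_two_mul, Real.cos_two_mul]
  rw [e4]
  exact mem_idbl (mem_idbl hq)

/-! ## `ε(k) − g`, and the constant `g_L = gFix/D` -/

/-- the certified Poincaré constant read in `ℝ`: `g_L = gFix L / D`. [folklore] -/
noncomputable def gR (L : ℕ) : ℝ := ((gFix L : ℤ) : ℝ) / ((D : ℤ) : ℝ)

/-- `ε` at natural coordinates. [folklore] -/
theorem epsT_natCast (L : ℕ) [NeZero L] {k1 k2 : ℕ} (h1 : k1 < L) (h2 : k2 < L) :
    epsT L (((k1 : ℕ) : ZMod L), ((k2 : ℕ) : ZMod L))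
      = 2 - Real.cos (2 * Real.pi * k1 / L) - Real.cos (2 * Real.pi * k2 / L) := by
  unfold epsT
  rw [ZMod.val_natCast, ZMod.val_natCast, Nat.mod_eq_of_lt h1, Nat.mod_eq_of_lt h2]

/-- ★ `ε(k) − g_L ∈ epsIv (cosTab L) (gFix L) k₁ k₂`. [folklore] -/
theorem mem_epsIv (L : ℕ) [NeZero L] (hL : 3 ≤ L) {k1 k2 : ℕ} (h1 : k1 < L) (h2 : k2 < L) :
    mem (epsT L (((k1 : ℕ) : ZMod L), ((k2 : ℕ) : ZMod L)) - gR L) (epsIv (cosTab L) (gFix L) k1 k2) := by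
  rw [epsT_natCast L h1 h2]
  unfold epsIv
  rw [getIv_cosTab h1, getIv_cosTab h2]
  have h0 : mem (2 - gR L) (2 * D - gFix L, 2 * D - gFix L) := by
    have := mem_exact (2 * D - gFix L)
    have e : (((2 * D - gFix L : ℤ)) : ℝ) / ((D : ℤ) : ℝ) = 2 - gR L := by
      unfold gR; push_cast; field_simp [ne_of_gt D_pos]
    rwa [e] at this
  have := mem_isub (mem_isub h0 (mem_cosIv hL h1)) (mem_cosIv hL h2)
  rw [show 2 - Real.cos (2 * Real.pi * k1 / L) - Real.cos (2 * Real.pi * k2 / L) - gR L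
      = 2 - gR L - Real.cos (2 * Real.pi * k1 / L) - Real.cos (2 * Real.pi * k2 / L) by ring]
  exact this

/-- ★ `¾ε₁ ≤ g_L`. [folklore] -/
theorem gFix_ge (L : ℕ) [NeZero L] (hL : 3 ≤ L) : 3 / 4 * eps1 L ≤ gR L := by
  have hc := mem_cosIv hL (show 1 < L by omega)
  unfold mem at hc
  obtain ⟨hlo, _⟩ := hc
  have hD := D_pos
  unfold gR eps1
  rw [le_div_iff₀ hD]
  have h1 := le_cdiv_mul_real (3 * (D - (cosIv L 1).1)) 4 (by norm_num)
  unfold gFix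
  push_cast at h1 hlo ⊢
  simp only [mul_one] at hlo
  nlinarith

/-- ★ `g_L < ε₁` from the parameter check `gFix L < D − hi(cos 2π/L)`. [folklore] -/
theorem gFix_lt (L : ℕ) [NeZero L] (hL : 3 ≤ L) (hchk : gFix L < D - (cosIv L 1).2) : gR L < eps1 L := by
  have hc := mem_cosIv hL (show 1 < L by omega)
  unfold mem at hc
  obtain ⟨_, hhi⟩ := hc
  have hD := D_pos
  unfold gR eps1
  rw [div_lt_iff₀ hD]
  have h1 : ((gFix L : ℤ) : ℝ) < ((D : ℤ) : ℝ) - (((cosIv L 1).2 : ℤ) : ℝ) := by exact_mod_cast hchk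
  simp only [Nat.cast_one, mul_one] at hhi
  nlinarith

end Hole2

end Summit.HubbardSuperconductivity.HubbardSuperconductivity.Theorems.AnisotropyChord.Transfer.Fibre3
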